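import Summits.HubbardSuperconductivity.HubbardSuperconductivity.Theses.ColourTheSpin
import Summits.HubbardSuperconductivity.HubbardSuperconductivity.Theorems.SgAnchorOrder.Negative.Freezing

/-!
# Disproof of `SgAnchorOrder` (stmt-HubbardSuperconductivity-16273, route `ColourTheSpin`, rank 3) —
# findings: KILLED, class `refuted-substantive` (strong-coupling freezing + flux ultralocality)

Disprover work file (cdisprove seat refuter-cdisprove-stmt-HubbardSuperconductivity-16273-0, cycle 1,
2026-08-17). Everything below is kernel-checked (no `sorry`).

INDEX
* §0 `sgAnchorOrder_iff_lit` — the crux is, BY `Iff.rfl`, the literature-form clause over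
  `spinGaugedHubbardTorus L U g` / `spinGaugedPairField L` / `SpinGauged.HasParticleNumber`
  (the inlined `let` block is definitionally these constants: `spinGaugedHubbardTorus_eq_inline`).
  Use this to move between the route text and `Literature…SpinGauged*` freely.
* §1 `not_sgAnchorOrder : ¬ SgAnchorOrder` — THE KILL, sorry-free, axioms {propext, choice,
  Quot.sound}. Composition of the landed negative lane
  `Theorems/SgAnchorOrder/Negative/{BlockForms,PairFibre,Freezing}.lean` (p152072, p152430, p152751,
  refuter-rattack-…-16273-0): `ceiling_lit` (every block ground state has ⟨Δ^g†Δ^g⟩ ≤ 33 L²‖ψ‖² once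
  `g ≥ G(L,U) = 1 + 192 L² √(2 C₁(L,U))`) and `gs_lit` (a normalised block ground state exists), at an
  even `L ≥ L₀` with `c L² > 33` and `g = max g₀ G`. The same composition is proposed for the tree as
  `Theorems/ColourTheSpinSgAnchorOrderRefutation.lean` (p155047 by the rattack seat; an identical,
  independently written file of this seat compiles rc 0 and is held back only to avoid a duplicate).
* §2 `pairCeiling_inline`, `groundStateExists_inline` — the two stubs of the registrar's
  `NegationSkeleton.lean` (`PairCeiling` with witness `A = 33`, `GroundStateExists`), stated over the
  crux's VERBATIM `let` block and closed; so `NegationSkeleton.not_SgAnchorOrder_of_stubs` is now an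
  unconditional second route to `¬ SgAnchorOrder`.
* §3 `order_ratio_le` — uniformity of the failure: at EVERY `(U, δ)` and every side `L ≥ 1`, for
  `g ≥ G(L,U)` every block ground state has `⟨Δ^g†Δ^g⟩/‖ψ‖² ≤ 33 L²`, i.e. the would-be order
  density `L⁻⁴⟨Δ^g†Δ^g⟩ ≤ 33 L⁻²`: the anchor is empty at every parameter point, not only generically
  (this is why the class is `substantive`, see REPAIRS).

MECHANISM (paper form; Lean in the Negative lane). `H_g = -(T+T†) + U D ⊗ 1 + g² (1 ⊗ Σ_b E_b)
+ g⁻² (1 ⊗ M)` with `E_b = 1 - Q_b`, `Q_b` = averaging of the link variable `u_b` over `Q₈`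
(`electricLink_eq_one_sub_linkAverage`). (i) Trial state `|s₀⟩ ⊗ const` (any `N_L`-configuration):
`⟨T⟩ = 0` because `Σ_{u∈Q₈} ρ(u) = 0` (`Q8.sum_rep`), `⟨Σ E_b⟩ = 0`, so the block ground energy is
`≤ C₁(L,U)` for `g ≥ 1`; and `Re⟨v,Hv⟩ ≥ -C₁‖v‖² + g² Σ_b ‖v - Q_b v‖²`; hence a ground state has
`Σ_b ‖ψ - Q_bψ‖² ≤ 2C₁‖ψ‖²/g²` (all Gauss sectors admitted: nothing forces flux, the links FREEZE into
the electric vacuum). (ii) The transported bond pair field `P = Σ_b ± P_b`,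
`P_b = Σ_{στ} c_{xσ}c_{x+eᵢ,τ} ⊗ (ερ(u_b))_{στ}`, multiplies link `b` by a function of ZERO `Q₈`-mean
(`sum_epsRep`), so `Q_b P_b Q_b = 0`: `P_b` CREATES one unit of electric flux on `b`; cross terms
`⟨P_b v, P_{b'} v⟩`, `b ≠ b'`, vanish on link-averaged vectors (`cross_vanish`) and are
`O(‖v - Q v‖·‖v‖)` in general (`cross_term_le`); with `‖P_b‖ ≤ 4`:
`‖Pv‖² ≤ (16|Bond L| + 48 θ |Bond L|²)‖v‖²` when every link is `θ`-close to its average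
(`pair_bound`). (iii) `θ = √(2C₁)/g`, `|Bond L| = 2L²` ⇒ `⟨ψ,P†Pψ⟩ ≤ 33 L²‖ψ‖²` for `g ≥ G(L,U)`.
Physically: at strong gauge coupling the all-sector ground states are a frozen classical charge
lattice gas; single hops AND the transported pair field both cost `g²`; bond–bond pair coherence is
`O(t²/g⁴)` (toy ED, kit j019493: all bond-pair observables `∝ g⁻⁴`, B₁g combination ≡ 0). The route
header's "pair motion at first order in `t`, `g`-independent effective model" is false for this
Hamiltonian.

REPAIRS TRIED (why `substantive`, not `misstated`).
* R1 bounded window `∀ g ∈ [g₀, g₁]` (or `g = g₀` only): NOT bitten by this witness — but that is the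
  corridor target `SgCorridorOrder` moved to larger `g`, i.e. the whole open problem with no anchor;
  and at every FIXED `g ≫ 1` the all-sector ground states are the frozen lattice gas above with
  `O(g⁻⁴)` bond-pair observables, so no `c > 0` is expected at any single large `g` either.
* R2 Gauss-law (gauge-invariant) sector only: same ceiling by the same proof with the gauge-invariant
  trial state `|N_L/2 doublons⟩ ⊗ const` (doublons are `SU(2)`, hence `Q₈`, singlets; `det ρ = 1`):
  block energy `≤ U N_L/2 + C₁`, links still freeze, `Q_b P_b Q_b = 0` is sector-blind ⇒
  `⟨Δ^g†Δ^g⟩ ≤ 33L²‖ψ‖²` for `g ≥ G'(L,U)`. (Not formalised: needs `Γ(ρ)` on doublon basis states and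
  the variational principle on `gaugeInvariantSubspace ∩ block`; ≈ 400 lines, no new idea.) Moreover
  the neutral strong-coupling liquid is an ON-SITE (`A₁g`) doublon gas: its `B₁g` bond projection
  vanishes identically (`Σ_i g_d(i) = 0`).
* R3 `c = c(g)` (order allowed to decay in `g`): consistent with `c(g) ~ t²/g⁴`, but then
  `SgCorridor : SgAnchorOrder → SgCorridorOrder` transfers nothing (no uniform floor to continue).
* R4 ground-state AVERAGE instead of EVERY ground state: the ceiling holds for every ground state,
  hence for every average — dead.
* R5 other finite `G ⊂ SU(2)` (binary tetrahedral/octahedral) or other transported bond bilinears: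
  `Σ_{u∈G} ρ(u) = 0` for every non-trivial irreducible `ρ` (Schur), so (i)–(iii) go through verbatim.
barrier-candidate: StrongGaugeCouplingFreezing — for a lattice-gauged fermion model whose electric
term is the projector off constant link functions, no gauge-covariant BOND operator built with a
non-trivial irreducible transporter has off-diagonal long-range order uniformly in `g → ∞`
(all sectors and neutral sector alike).

WHAT SURVIVES. `SgCorridorOrder` (rank 0, bounded `g ∈ (0, g₀]`) and `SgEndpoint` (rank 2) are not
touched by this argument; `SgCorridor := SgAnchorOrder → SgCorridorOrder` becomes vacuously TRUE and
worthless. Route kill criterion (header): `refuted:SgAnchorOrder` closes route ColourTheSpin.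

USED FROM OTHERS (cited): refuter-rreview-0816T18-1-0 (EVIDENCE v1–v3, CTS_SchurFacts.lean: the
paper proof and `sum_rQ`); planner-skel-…-16273-0 (`NegationSkeleton.lean`: the two-stub split and the
sorry-free composition, reused in §1–§2); planner-cstrat-…-16273-b1-0 (STRATEGY-CENSUS, line
`freeze_flux_negation`: repair landscape R1–R5); refuter-rattack-…-16273-0 (the landed Negative lane).
This seat's own contributions: independent derivation of (i)–(iii) before reading the item evidence
(NOTES.md), the `Iff.rfl` bridge §0, the closed stubs §2, the composed kill §1 (rc 0).
-/

noncomputable section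

set_option linter.dupNamespace false
set_option linter.unusedVariables false

namespace Summit.HubbardSuperconductivity.HubbardSuperconductivity.Cruxes.SgAnchorOrder.Disproof

open Literature.MathematicalPhysics.QuantumLattice
open Summit.HubbardSuperconductivity.HubbardSuperconductivity.Theses.ColourTheSpin
open Summit.HubbardSuperconductivity.HubbardSuperconductivity.Theorems
open scoped Matrix

/-! ### §0 The crux in literature form (definitional) -/

/-- The per-`(g, L)` clause of `SgAnchorOrder` over the library constants: every ground state of the
`N_L`-block of `spinGaugedHubbardTorus L U g` has transported `B₁g` pair order `≥ c L⁴ ‖ψ‖²`. -/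
def LitClause (L : ℕ) [NeZero L] (U δ g c : ℝ) : Prop :=
  ∀ ψ : {ik : SpinGauged.Index L Q8 //
      SpinGauged.HasParticleNumber L (2 * ⌊(1 - δ) * (L : ℝ) ^ 2 / 2⌋₊) ik} → ℂ,
    (ψ ≠ 0 ∧ ∃ E : ℝ, (spinGaugedHubbardTorus L U g).toBlock
        (SpinGauged.HasParticleNumber L (2 * ⌊(1 - δ) * (L : ℝ) ^ 2 / 2⌋₊))
        (SpinGauged.HasParticleNumber L (2 * ⌊(1 - δ) * (L : ℝ) ^ 2 / 2⌋₊)) *ᵥ ψ = (E : ℂ) • ψ ∧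
      ∀ φ : {ik : SpinGauged.Index L Q8 //
          SpinGauged.HasParticleNumber L (2 * ⌊(1 - δ) * (L : ℝ) ^ 2 / 2⌋₊) ik} → ℂ,
        E * (star φ ⬝ᵥ φ).re ≤ (star φ ⬝ᵥ (spinGaugedHubbardTorus L U g).toBlock
          (SpinGauged.HasParticleNumber L (2 * ⌊(1 - δ) * (L : ℝ) ^ 2 / 2⌋₊))
          (SpinGauged.HasParticleNumber L (2 * ⌊(1 - δ) * (L : ℝ) ^ 2 / 2⌋₊)) *ᵥ φ).re) →
    c * (L : ℝ) ^ 4 * (star ψ ⬝ᵥ ψ).re ≤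
      (star ψ ⬝ᵥ ((spinGaugedPairField L)ᴴ * spinGaugedPairField L).toBlock
        (SpinGauged.HasParticleNumber L (2 * ⌊(1 - δ) * (L : ℝ) ^ 2 / 2⌋₊))
        (SpinGauged.HasParticleNumber L (2 * ⌊(1 - δ) * (L : ℝ) ^ 2 / 2⌋₊)) *ᵥ ψ).re

/-- **The crux is definitionally its literature form** (`Iff.rfl`): the inlined `let m/iv/r/hop/H/P/p`
block is `spinGaugedHubbardTorus L U g`, `spinGaugedPairField L`, `SpinGauged.HasParticleNumber`. -/
theorem sgAnchorOrder_iff_lit :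
    SgAnchorOrder ↔
      ∃ U : ℝ, 0 < U ∧ ∃ δ ∈ Set.Ioo (0 : ℝ) (1 / 2), ∃ g₀ : ℝ, 0 < g₀ ∧ ∃ c : ℝ, 0 < c ∧
        ∃ L₀ : ℕ, ∀ g : ℝ, g₀ ≤ g → ∀ (L : ℕ) [NeZero L], L₀ ≤ L → Even L → LitClause L U δ g c :=
  Iff.rfl

/-! ### §1 The kill -/

/-- **`¬ SgAnchorOrder`** (refuted-substantive): given `(U, δ, g₀, c, L₀)`, take an even `L ≥ L₀` with
`c L² > 33` and `g = max g₀ G(L,U)`; a normalised ground state of the `N_L`-block exists (`gs_lit`)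
and has `⟨Δ^g†Δ^g⟩ ≤ 33 L²` (`ceiling_lit`, strong-coupling freezing + flux ultralocality), against the
crux's `≥ c L⁴ > 33 L²`. -/
theorem not_sgAnchorOrder : ¬ SgAnchorOrder := by
  intro hAnchor
  obtain ⟨U, hU, δ, hδ, g₀, hg₀, c, hc, L₀, hcrux⟩ := hAnchor
  obtain ⟨n, hn⟩ := exists_nat_gt (33 / c)
  obtain ⟨L, hL0, hLn, hLeven, hLpos⟩ : ∃ L : ℕ, L₀ ≤ L ∧ n < L ∧ Even L ∧ 0 < L :=
    ⟨2 * (n + L₀ + 1), by omega, by omega, ⟨n + L₀ + 1, by ring⟩, by omega⟩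
  haveI : NeZero L := ⟨Nat.pos_iff_ne_zero.mp hLpos⟩
  have hL2pos : (0 : ℝ) < (L : ℝ) ^ 2 := by positivity
  have hAL : 33 < c * (L : ℝ) ^ 2 := by
    have h1 : (n : ℝ) < (L : ℝ) := by exact_mod_cast hLn
    have hL1 : (1 : ℝ) ≤ (L : ℝ) := by exact_mod_cast hLpos
    have h2 : (L : ℝ) ≤ (L : ℝ) ^ 2 := by nlinarith
    have h3 : 33 / c < (L : ℝ) ^ 2 := lt_of_lt_of_le (hn.trans h1) h2
    have h4 : 33 < (L : ℝ) ^ 2 * c := (div_lt_iff₀ hc).mp h3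
    linarith [mul_comm ((L : ℝ) ^ 2) c]
  obtain ⟨G, hG⟩ := ColourTheSpinSgAnchorOrderRefutation.ceiling_lit L U δ hδ
  have hcr := hcrux (max g₀ G) (le_max_left g₀ G) L hL0 hLeven
  obtain ⟨ψ, hnorm, hGS⟩ := ColourTheSpinSgAnchorOrderRefutation.gs_lit L U δ (max g₀ G) hδ
    (fun ik : SpinGauged.Index L Q8 => ik.1.card = 2 * ⌊(1 - δ) * (L : ℝ) ^ 2 / 2⌋₊)
    (instD := inferInstance) rfl
  have h1 : c * (L : ℝ) ^ 4 * (star ψ ⬝ᵥ ψ).re ≤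
      (star ψ ⬝ᵥ ((spinGaugedPairField L)ᴴ * spinGaugedPairField L).toBlock
        (fun ik : SpinGauged.Index L Q8 => ik.1.card = 2 * ⌊(1 - δ) * (L : ℝ) ^ 2 / 2⌋₊)
        (fun ik : SpinGauged.Index L Q8 => ik.1.card = 2 * ⌊(1 - δ) * (L : ℝ) ^ 2 / 2⌋₊) *ᵥ ψ).re :=
    hcr ψ hGS
  have h2 := hG (max g₀ G) (le_max_right g₀ G)
    (fun ik : SpinGauged.Index L Q8 => ik.1.card = 2 * ⌊(1 - δ) * (L : ℝ) ^ 2 / 2⌋₊)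
    (instD := inferInstance) rfl ψ hGS
  have hn1 : (star ψ ⬝ᵥ ψ).re = 1 := by rw [hnorm]; simp
  have h3 : c * (L : ℝ) ^ 4 * (star ψ ⬝ᵥ ψ).re ≤ 33 * (L : ℝ) ^ 2 * (star ψ ⬝ᵥ ψ).re :=
    le_trans h1 h2
  rw [hn1, mul_one, mul_one] at h3
  have h4 : 33 * (L : ℝ) ^ 2 < c * (L : ℝ) ^ 2 * (L : ℝ) ^ 2 := mul_lt_mul_of_pos_right hAL hL2pos
  have h5 : c * (L : ℝ) ^ 4 = c * (L : ℝ) ^ 2 * (L : ℝ) ^ 2 := by ring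
  linarith

/-! ### §2 The registrar's negation stubs, closed (verbatim `let` block of the crux) -/

/-- **Stub 1 of `NegationSkeleton.lean` (`PairCeiling`), PROVED with witness `A = 33`**: for every
`U > 0`, `δ ∈ (0,½)`, `L ≥ 1` there is `G = G(L,U)` such that for `g ≥ G` every ground state of the
`N_L`-block of the inlined `H_g(L,U)` has `⟨ψ,(PᴴP)_B ψ⟩.re ≤ 33·L²·(ψ†ψ).re`. -/
theorem pairCeiling_inline :
    ∃ A : ℝ, ∀ U : ℝ, 0 < U → ∀ δ ∈ Set.Ioo (0 : ℝ) (1 / 2), ∀ (L : ℕ) [NeZero L], ∃ G : ℝ, ∀ g : ℝ, G ≤ g → (let m : Fin 2 × ZMod 4 → Fin 2 × ZMod 4 → Fin 2 × ZMod 4 := fun u v => (u.1 + v.1, if u.1 = 0 then (if v.1 = 0 then u.2 + v.2 else v.2 - u.2) else if v.1 = 0 then u.2 + v.2 else 2 + v.2 - u.2); let iv : Fin 2 × ZMod 4 → Fin 2 × ZMod 4 := fun u => (u.1, if u.1 = 0 then -u.2 else u.2 + 2); let r : Fin 2 × ZMod 4 → Fin 2 → Fin 2 → ℂ := fun u σ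 τ => if u.1 = 0 then (if σ = τ then (if σ = 0 then Complex.I else -Complex.I) ^ u.2.val else 0) else if σ = τ then 0 else if σ = 0 then -(-Complex.I) ^ u.2.val else Complex.I ^ u.2.val; let hop := ∑ b : GaugedHubbard.Bond L, ∑ σ : Fin 2, ∑ τ : Fin 2, Matrix.kroneckerMap (· * ·) (creation (orb b.1 σ) * annihilation (orb (b.1.shift b.2) τ)) (Matrix.diagonal fun k : GaugedHubbard.Bond L → Fin 2 × ZMod 4 => r (k b) σ τ); let H := -(hop + hopᴴ) + ((U : ℝ) : ℂ) • Matrix.kroneckerMap (· * ·) (∑ x : FermionTorus 2 L, numberOp x 0 * numberOp x 1) (1 : Matrix (GaugedHubbard.Bond L → Fin 2 × ZMod 4) (GaugedHubbard.Bond L → Fin 2 × ZMod 4) ℂ) + ((g ^ 2 : ℝ) : ℂ) • Matrix.kroneckerMap (· * ·) (1 : Matrix (Finset (Orb (FermionTorus 2 L))) _ ℂ) (∑ b : GaugedHubbard.Bond L, Matrix.of fun k k' : GaugedHubbard.Bond L → Fin 2 × ZMod 4 => if k' = Function.update k b (k' b) then (if k b = k' b then (1 : ℂ) else 0) - 1 /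 8 else 0) + ((1 / g ^ 2 : ℝ) : ℂ) • Matrix.kroneckerMap (· * ·) (1 : Matrix (Finset (Orb (FermionTorus 2 L))) _ ℂ) (Matrix.diagonal fun k : GaugedHubbard.Bond L → Fin 2 × ZMod 4 => ∑ x : FermionTorus 2 L, (1 - (r (m (m (m (k (x, 0)) (k (x.shift 0, 1))) (iv (k (x.shift 1, 0)))) (iv (k (x, 1)))) 0 0 + r (m (m (m (k (x, 0)) (k (x.shift 0, 1))) (iv (k (x.shift 1, 0)))) (iv (k (x, 1)))) 1 1) / 2)); let P := ∑ b : GaugedHubbard.Bond L, (if b.2 = 0 then (1 : ℂ) else -1) • ∑ σ : Fin 2, ∑ τ : Fin 2, Matrix.kroneckerMap (· * ·) (annihilation (orb b.1 σ) * annihilation (orb (b.1.shift b.2) τ)) (Matrix.diagonal fun k : GaugedHubbard.Bond L → Fin 2 × ZMod 4 => if σ = 0 then r (k b) 1 τ else -r (k b) 0 τ); let p := fun ik : Finset (Orb (FermionTorus 2 L)) × (GaugedHubbard.Bond L → Fin 2 × ZMod 4) => ik.1.card = 2 * ⌊(1 - δ) * (L : ℝ) ^ 2 / 2⌋₊; ∀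 ψ : {ik // p ik} → ℂ, (ψ ≠ 0 ∧ ∃ E : ℝ, H.toBlock p p *ᵥ ψ = (E : ℂ) • ψ ∧ ∀ φ : {ik // p ik} → ℂ, E * (star φ ⬝ᵥ φ).re ≤ (star φ ⬝ᵥ H.toBlock p p *ᵥ φ).re) → (star ψ ⬝ᵥ (Pᴴ * P).toBlock p p *ᵥ ψ).re ≤ A * (L : ℝ) ^ 2 * (star ψ ⬝ᵥ ψ).re) := by
  refine ⟨33, fun U _ δ hδ L _ => ?_⟩
  obtain ⟨G, hG⟩ := ColourTheSpinSgAnchorOrderRefutation.ceiling_lit L U δ hδ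
  refine ⟨G, fun g hg => ?_⟩
  dsimp only
  intro ψ hψ
  exact hG g hg (fun ik : SpinGauged.Index L Q8 => ik.1.card = 2 * ⌊(1 - δ) * (L : ℝ) ^ 2 / 2⌋₊)
    (instD := inferInstance) rfl ψ hψ

/-- **Stub 2 of `NegationSkeleton.lean` (`GroundStateExists`), PROVED**: for all `U, g`, `δ ∈ (0,½)`,
`L ≥ 1` the `N_L`-block of the inlined `H_g(L,U)` has a normalised ground state in the crux's own
sense (Hermitian block on a non-empty index type; bottom eigenvector minimises the Rayleigh quotient). -/
theorem groundStateExists_inline :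
    ∀ (U δ g : ℝ) (L : ℕ) [NeZero L], δ ∈ Set.Ioo (0 : ℝ) (1 / 2) → (let m : Fin 2 × ZMod 4 → Fin 2 × ZMod 4 → Fin 2 × ZMod 4 := fun u v => (u.1 + v.1, if u.1 = 0 then (if v.1 = 0 then u.2 + v.2 else v.2 - u.2) else if v.1 = 0 then u.2 + v.2 else 2 + v.2 - u.2); let iv : Fin 2 × ZMod 4 → Fin 2 × ZMod 4 := fun u => (u.1, if u.1 = 0 then -u.2 else u.2 + 2); let r : Fin 2 × ZMod 4 → Fin 2 → Fin 2 → ℂ := fun u σ τ => if u.1 = 0 then (if σ = τ then (if σ = 0 then Complex.I else -Complex.I) ^ u.2.val else 0) else if σ = τ then 0 else if σ = 0 then -(-Complex.I) ^ u.2.val else Complex.I ^ u.2.val; let hop := ∑ b : GaugedHubbard.Bond L, ∑ σ : Fin 2, ∑ τ : Fin 2, Matrix.kroneckerMap (· * ·) (creation (orb b.1 σ) * annihilation (orb (b.1.shift b.2) τ)) (Matrix.diagonal fun k : GaugedHubbard.Bond L → Fin 2 × ZMod 4 => r (k b) σ τ); let H := -(hop + hopᴴ) + ((U : ℝ) : ℂ)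 • Matrix.kroneckerMap (· * ·) (∑ x : FermionTorus 2 L, numberOp x 0 * numberOp x 1) (1 : Matrix (GaugedHubbard.Bond L → Fin 2 × ZMod 4) (GaugedHubbard.Bond L → Fin 2 × ZMod 4) ℂ) + ((g ^ 2 : ℝ) : ℂ) • Matrix.kroneckerMap (· * ·) (1 : Matrix (Finset (Orb (FermionTorus 2 L))) _ ℂ) (∑ b : GaugedHubbard.Bond L, Matrix.of fun k k' : GaugedHubbard.Bond L → Fin 2 × ZMod 4 => if k' = Function.update k b (k' b) then (if k b = k' b then (1 : ℂ) else 0) - 1 / 8 else 0) + ((1 / g ^ 2 : ℝ) : ℂ) • Matrix.kroneckerMap (· * ·) (1 : Matrix (Finset (Orb (FermionTorus 2 L))) _ ℂ) (Matrix.diagonal fun k : GaugedHubbard.Bond L → Fin 2 × ZMod 4 => ∑ x : FermionTorus 2 L, (1 - (r (m (m (m (k (x, 0)) (k (x.shift 0, 1))) (iv (k (x.shift 1, 0)))) (iv (k (x, 1)))) 0 0 + r (m (m (m (k (x, 0)) (k (x.shift 0, 1))) (iv (k (x.shift 1, 0)))) (iv (k (x, 1)))) 1 1) / 2)); let p :=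 fun ik : Finset (Orb (FermionTorus 2 L)) × (GaugedHubbard.Bond L → Fin 2 × ZMod 4) => ik.1.card = 2 * ⌊(1 - δ) * (L : ℝ) ^ 2 / 2⌋₊; ∃ ψ : {ik // p ik} → ℂ, star ψ ⬝ᵥ ψ = 1 ∧ (ψ ≠ 0 ∧ ∃ E : ℝ, H.toBlock p p *ᵥ ψ = (E : ℂ) • ψ ∧ ∀ φ : {ik // p ik} → ℂ, E * (star φ ⬝ᵥ φ).re ≤ (star φ ⬝ᵥ H.toBlock p p *ᵥ φ).re)) := by
  intro U δ g L _ hδ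
  dsimp only
  exact ColourTheSpinSgAnchorOrderRefutation.gs_lit L U δ g hδ
    (fun ik : SpinGauged.Index L Q8 => ik.1.card = 2 * ⌊(1 - δ) * (L : ℝ) ^ 2 / 2⌋₊)
    (instD := inferInstance) rfl

/-! ### §3 Uniformity of the failure in `(U, δ, L)` -/

/-- **The anchor is empty at EVERY parameter point.** For every `U`, every `δ ∈ (0,½)` and every side
`L ≥ 1` there is `G(L,U)` such that for all `g ≥ G` every ground state `ψ` of the `N_L`-block of
`H_g(L,U)` has `⟨ψ, Δ_d^g†Δ_d^g ψ⟩ ≤ 33 L² ‖ψ‖²` — the would-be order density `L⁻⁴⟨Δ^g†Δ^g⟩` is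
`≤ 33 L⁻²`, uniformly in the ground state. (Literature form; `ceiling_lit` specialised to the block
predicate.) -/
theorem order_ratio_le (U δ : ℝ) (hδ : δ ∈ Set.Ioo (0 : ℝ) (1 / 2)) (L : ℕ) [NeZero L] :
    ∃ G : ℝ, ∀ g : ℝ, G ≤ g →
      ∀ ψ : {ik : SpinGauged.Index L Q8 //
          SpinGauged.HasParticleNumber L (2 * ⌊(1 - δ) * (L : ℝ) ^ 2 / 2⌋₊) ik} → ℂ,
        (ψ ≠ 0 ∧ ∃ E : ℝ, (spinGaugedHubbardTorus L U g).toBlock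
            (SpinGauged.HasParticleNumber L (2 * ⌊(1 - δ) * (L : ℝ) ^ 2 / 2⌋₊))
            (SpinGauged.HasParticleNumber L (2 * ⌊(1 - δ) * (L : ℝ) ^ 2 / 2⌋₊)) *ᵥ ψ = (E : ℂ) • ψ ∧
          ∀ φ : {ik : SpinGauged.Index L Q8 //
              SpinGauged.HasParticleNumber L (2 * ⌊(1 - δ) * (L : ℝ) ^ 2 / 2⌋₊) ik} → ℂ,
            E * (star φ ⬝ᵥ φ).re ≤ (star φ ⬝ᵥ (spinGaugedHubbardTorus L U g).toBlock
              (SpinGauged.HasParticleNumber L (2 * ⌊(1 - δ) * (L : ℝ) ^ 2 / 2⌋₊))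
              (SpinGauged.HasParticleNumber L (2 * ⌊(1 - δ) * (L : ℝ) ^ 2 / 2⌋₊)) *ᵥ φ).re) →
        (star ψ ⬝ᵥ ((spinGaugedPairField L)ᴴ * spinGaugedPairField L).toBlock
            (SpinGauged.HasParticleNumber L (2 * ⌊(1 - δ) * (L : ℝ) ^ 2 / 2⌋₊))
            (SpinGauged.HasParticleNumber L (2 * ⌊(1 - δ) * (L : ℝ) ^ 2 / 2⌋₊)) *ᵥ ψ).re ≤
          33 * (L : ℝ) ^ 2 * (star ψ ⬝ᵥ ψ).re := by
  obtain ⟨G, hG⟩ := ColourTheSpinSgAnchorOrderRefutation.ceiling_lit L U δ hδ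
  exact ⟨G, fun g hg ψ hψ => hG g hg _ rfl ψ hψ⟩

/-- **Hence no `c > 0` works at ANY `(U, δ)`**: for every `U`, `δ ∈ (0,½)`, `g₀`, `c > 0`, `L₀` there
are `g ≥ g₀` and an even `L ≥ L₀` at which the literature-form clause fails (the negation of the crux
with the two outer existentials turned into universals — strictly more than `¬ SgAnchorOrder`, which
only needs this for `U > 0`). -/
theorem litClause_fails (U δ g₀ c : ℝ) (hδ : δ ∈ Set.Ioo (0 : ℝ) (1 / 2)) (hc : 0 < c) (L₀ : ℕ) :
    ∃ g : ℝ, g₀ ≤ g ∧ ∃ (L : ℕ) (_ : NeZero L), L₀ ≤ L ∧ Even L ∧ ¬ LitClause L U δ g c := by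
  obtain ⟨n, hn⟩ := exists_nat_gt (33 / c)
  obtain ⟨L, hL0, hLn, hLeven, hLpos⟩ : ∃ L : ℕ, L₀ ≤ L ∧ n < L ∧ Even L ∧ 0 < L :=
    ⟨2 * (n + L₀ + 1), by omega, by omega, ⟨n + L₀ + 1, by ring⟩, by omega⟩
  haveI hL : NeZero L := ⟨Nat.pos_iff_ne_zero.mp hLpos⟩
  have hL2pos : (0 : ℝ) < (L : ℝ) ^ 2 := by positivity
  have hAL : 33 < c * (L : ℝ) ^ 2 := by
    have h1 : (n : ℝ) < (L : ℝ) := by exact_mod_cast hLn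
    have hL1 : (1 : ℝ) ≤ (L : ℝ) := by exact_mod_cast hLpos
    have h2 : (L : ℝ) ≤ (L : ℝ) ^ 2 := by nlinarith
    have h3 : 33 / c < (L : ℝ) ^ 2 := lt_of_lt_of_le (hn.trans h1) h2
    have h4 : 33 < (L : ℝ) ^ 2 * c := (div_lt_iff₀ hc).mp h3
    linarith [mul_comm ((L : ℝ) ^ 2) c]
  obtain ⟨G, hG⟩ := order_ratio_le U δ hδ L
  refine ⟨max g₀ G, le_max_left g₀ G, L, hL, hL0, hLeven, fun hcl => ?_⟩
  obtain ⟨ψ, hnorm, hGS⟩ := ColourTheSpinSgAnchorOrderRefutation.gs_lit L U δ (max g₀ G) hδ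
    (SpinGauged.HasParticleNumber L (2 * ⌊(1 - δ) * (L : ℝ) ^ 2 / 2⌋₊)) rfl
  have h1 := hcl ψ hGS
  have h2 := hG (max g₀ G) (le_max_right g₀ G) ψ hGS
  have hn1 : (star ψ ⬝ᵥ ψ).re = 1 := by rw [hnorm]; simp
  have h3 := le_trans h1 h2
  rw [hn1, mul_one, mul_one] at h3
  have h4 : 33 * (L : ℝ) ^ 2 < c * (L : ℝ) ^ 2 * (L : ℝ) ^ 2 := mul_lt_mul_of_pos_right hAL hL2pos
  have h5 : c * (L : ℝ) ^ 4 = c * (L : ℝ) ^ 2 * (L : ℝ) ^ 2 := by ring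
  linarith

end Summit.HubbardSuperconductivity.HubbardSuperconductivity.Cruxes.SgAnchorOrder.Disproof
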